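import Summits.CriticalPhenomena.PercolationContinuityZ3.Theorems.Transplant.SkelFrmQuasiBChoiceGeomV
import Summits.CriticalPhenomena.PercolationContinuityZ3.Theorems.Transplant.SkelFrmQuasiBChoiceDefsVPx
import Summits.CriticalPhenomena.PercolationContinuityZ3.Theorems.Transplant.PlanarSkeletonFrmQuasiDefs
import HarnessLib

/-!
# GEN-Q PORT (WAVE-Q table v0.8 section 2, row G280, U-level L?; captain R-6/R-7 2026-08-27: carrier token swap `PlanarSkeletonFrmFrom ↦ PlanarSkeletonFrmQuasi`)
# of the tree module «Transplant/SkelFrmFromBChoiceGeomVPx» (sha256 e52a6fe14aa551e1…) onto the quasi-step carrier `PlanarSkeletonFrmQuasi` (p507026): «SkelFrmQuasiBChoiceGeomVPx»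

HAND HUNK (ii) (captain R-16 (a), this seat): `NegB.steps_φL ↦ NegB.qStepsN_φL` (p3-g30's G026 producer, cost `Φ.M`) feeding my «SkelFrmQuasiBChoiceGeomV» `geom_fineA_at_bV {M} (hq : QStepsN …)` with `colQ_schedOfT` (Φ.M form).

ORIGINAL TITLE: 

builds on p205010 (kernel theorem, internal audit signed; external expert review pending) — nothing in this file uses p205010; NOTHING is claimed about any open node
((N3-b), the end state).  Lane `prim-bschramm`, seat `prim-bschramm-stmt` (gen 33; GEN-Q column pen; tool = captain gen-1 g4's port_genq.py R-14 --cone + p3-g30's T1 patch).  Helper file (`--supports stmt-CriticalPhenomena-4575 --as helper`).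
PORT RULES (U-wave r1–r4 re-used, GEN-Q hunk classes of p3-g29 #6136): declaration order, names and proof texts are those of «SkelFrmFromBChoiceGeomVPx», byte-identical except
(i) the carrier token `PlanarSkeletonFrmFrom ↦ PlanarSkeletonFrmQuasi` in binders, `namespace`/`end` lines and qualified names (module names `SkelFrmFrom… ↦ SkelFrmQuasi…`
in imports of already-ported rows); (ii) `Φ.step ↦ Φ.qstep` with the called Steps lemma replaced by its `…Q`/`_q` twin and the cost `Φ.M` threaded (none in this file unless
listed below); (iii) `Φ.cyl_connected ↦ Φ.cyl_reach` readers (none unless listed); (iv) graph-ball radii / window floors ×`Φ.M` (none unless listed).  Carrier-free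
residents stay imported/exported from the original «SkelFrmBChoiceGeomVPx» exactly as in the FrmFrom port.  Docstrings and citations are the original's.

-/

noncomputable section

open scoped Classical

namespace Summit.CriticalPhenomena.PercolationContinuityZ3.Theorems.Transplant

open MeasureTheory Literature.Probability.Percolation Literature.Probability.LatticeModels SimpleGraph KNCells KNLevels
open Literature.Barriers.CriticalPhenomena (HasExponentialGrowth)

namespace PlanarSkeletonFrmQuasi

open SkelConc (Consts)
open Skelφ.StepI (DataN DataNS OutNS)

/-- **THE GEOMETRIC OBLIGATION OF THE GEN CHOICE FUNCTION OF RECORD AT PROXY RADIUS `D`** — for every box/width/pair/fibre/creep/room/arrival slot: root `t`, `K ≥ κ.K₀`,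
`RunGeom`, `AnchGeom`, `SepGeom₂`, `ExitGeom`, `StepsGeom`, `LevelGeom` of the anchored cells `ΓQV` with `FDQV`/`LDQV` at every `(O, q)` with `AtQNQ` (U's
`geomHoldsNQFn_frmChoiceAllQ3V`, proof verbatim over `geom_fineA_at_bV`). [cite: KozmaNitzan2024, §4 Theorem 6 (pp. 25–31)] -/
theorem geomHoldsNQFnPxAt_frmChoiceAllQ3VPx (D : ℕ) (gv fv : PlanarSkeletonFrmQuasi.Neg.FSlot) (Pv : NegB.PSlot) (Sv : NegB.SSlot) (cv hv : NegB.CSlot) (bv : NegB.BSlot) :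
    GeomHoldsNQFnPxAt (frmChoiceAllQ3VPx D gv fv Pv Sv cv hv bv) := by
  intro κ V _ _ G _ Φ hg t ht hP p hp0 hp1 hC O q hAt
  obtain ⟨-, -, hR, -, -⟩ := Skelφ.StepI.OutO.FactsO.shared hAt.1.factsO
  obtain ⟨h1', h2, -, h4, h5, h6, h7, h8, h9⟩ := NegB.geom_fineA_at_bV κ Φ t p O.merged (NegB.gOf κ Φ t p O gv) (NegB.fOf κ Φ t p O fv)
    (NegB.cOf κ Φ t p O gv fv cv) (NegB.hOf κ Φ t p O gv fv hv)
    (NegB.lip_φL κ Φ t p O.D O.DT.toDataN O.ori (NegB.gOf κ Φ t p O gv) (NegB.fOf κ Φ t p O fv))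
    (NegB.qStepsN_φL κ Φ t p O.D O.DT.toDataN O.ori (NegB.gOf κ Φ t p O gv) (NegB.fOf κ Φ t p O fv))
    (NegB.eqNumL_of_factsO κ Φ t p O.D O.DT.toDataN O.ori _ _ hR (Skelφ.StepI.OutO.FactsO.clauses hAt.1.factsO))
    (NegB.schedOfT_WFS2 κ Φ t p O.merged (NegB.gOf κ Φ t p O gv) (NegB.fOf κ Φ t p O fv) (NegB.cOf κ Φ t p O gv fv cv)
      (Sv κ Φ t p O.merged (NegB.gOf κ Φ t p O gv) (NegB.fOf κ Φ t p O fv) q))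
    (NegB.colQ_schedOfT κ Φ t p O.merged (NegB.gOf κ Φ t p O gv) (NegB.fOf κ Φ t p O fv) (NegB.cOf κ Φ t p O gv fv cv)
      (Sv κ Φ t p O.merged (NegB.gOf κ Φ t p O gv) (NegB.fOf κ Φ t p O fv) q))
    (NegB.bOf_leV κ Φ t p O gv fv cv hv bv)
  exact ⟨h1', h2, h4, h5, h6, h7, h8, h9⟩

end PlanarSkeletonFrmQuasi

end Summit.CriticalPhenomena.PercolationContinuityZ3.Theorems.Transplant

end
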